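import Mathlib
import Literature.Combinatorics.SimpleGraph.LovaszTheta
import Literature.Computability.Complexity.ExtMonotoneGates
import Literature.Computability.Complexity.CliqueTestGraphs
import Summits.PneNP.PneNP.Theorems.ConvexRankGatesThetaGateKillsRazborovPair

/-!
# The Lovász theta programme as ONE CONV gate (anchored-theta refutation, part A)

Part of the refutation of `stub_convReplaceable` (line `width-threshold-certificate-sparsity` of
crux stmt-PneNP-10682, `ConvexRankGates.CliqueExtLowerBound`) by the ANCHORED THETA GATE; the final
theorem is `stub_convReplaceable_false` in `ConvReplaceableFalse.lean`, whose module docstring has the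
overview. Witness: at `c = 3`, for every `a`, localities `r = 3, s = 4`, at every large `m = n + 2`, the
theta programme on the `n+1` non-anchor vertices with clique parameter `k-1` (`k = ⌈m^{1/4}⌉₊`), fed
with children `d_j = {{e₀, p_j}}`, `c_j = {{e₀, f(α,γ), f(β,γ)} : γ < h}`, is not replaceable by any
monotone circuit of size `m^a`: Jukna's criterion on the derived coordinates kills both exits.
-/

set_option linter.dupNamespace false

namespace Summit.PneNP.PneNP.Theorems.CliqueExtLowerBound.Negative

open Literature.Computability.Complexity Literature.Combinatorics.SimpleGraph Matrix Finset Filter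

noncomputable section

/-! ## A. The theta gate -/

/-- Edge slots of `K_n` (the coordinates of the theta gate). -/
abbrev EP (n : ℕ) : Type := (⊤ : SimpleGraph (Fin n)).edgeSet

/-- Number of coordinates of the theta gate on `n` vertices. -/
def nP (n : ℕ) : ℕ := Fintype.card (EP n)

/-- The enumeration of the coordinates. -/
def eqv (n : ℕ) : EP n ≃ Fin (nP n) := Fintype.equivFin (EP n)

/-- Constraint indices of the theta programme: `tr Y ≤ 1`, `-tr Y ≤ -1`, `-⟨J,Y⟩ ≤ -q`, `± Y_ab ≤ [x_ab]`. -/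
abbrev ThI (n : ℕ) : Type := Unit ⊕ Unit ⊕ Unit ⊕ (Fin n × Fin n × Bool)

/-- The all-ones matrix. -/
def thJ (n : ℕ) : Matrix (Fin n) (Fin n) ℝ := Matrix.of fun _ _ => 1

/-- Constraint matrices. -/
def thA (n : ℕ) : ThI n → Matrix (Fin n) (Fin n) ℝ :=
  Sum.elim (fun _ => 1) (Sum.elim (fun _ => -1) (Sum.elim (fun _ => -thJ n)
    (fun t => Matrix.single t.2.1 t.1 (if t.1 = t.2.1 then 0 else if t.2.2 then 1 else -1))))

/-- Constraint constants. -/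
def thb (n q : ℕ) : ThI n → ℝ :=
  Sum.elim (fun _ => 1) (Sum.elim (fun _ => -1) (Sum.elim (fun _ => -(q : ℝ)) (fun _ => 0)))

/-- Constraint couplings to the inputs (nonnegative). -/
def thB (n : ℕ) : ThI n → Fin (nP n) → ℝ :=
  Sum.elim (fun _ _ => 0) (Sum.elim (fun _ _ => 0) (Sum.elim (fun _ _ => 0)
    (fun t j => if (((eqv n).symm j : EP n) : Sym2 (Fin n)) = s(t.1, t.2.1) then 1 else 0)))

/-- Feasibility of the theta programme at the input `v` (Lovász 1979; Jukna 2012, Lemma 9.27). [folklore] -/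
def ThetaFeas (n q : ℕ) (v : Fin (nP n) → Bool) : Prop :=
  ∃ Y : Matrix (Fin n) (Fin n) ℝ, Y.PosSemidef ∧
    ∀ o : ThI n, (thA n o * Y).trace ≤ thb n q o + ∑ j, thB n o j * (if v j then (1 : ℝ) else 0)

open Classical in
/-- **The theta gate** on `n` vertices with clique parameter `q`. -/
abbrev thetaGate (n q : ℕ) : GateFn := ⟨nP n, fun v => decide (ThetaFeas n q v)⟩

/-- The theta gate has `nP n` inputs (definitional). -/
theorem thetaGate_fst (n q : ℕ) : (thetaGate n q).1 = nP n := rfl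

/-- The theta gate accepts `v` iff the theta programme is feasible at `v`. -/
theorem thetaGate_snd_eq_true_iff (n q : ℕ) (v : Fin (nP n) → Bool) :
    (thetaGate n q).2 v = true ↔ ThetaFeas n q v := by
  classical
  simp

/-- The input couplings of the theta programme are nonnegative (`B ≥ 0`). -/
theorem thB_nonneg (n : ℕ) (o : ThI n) (j : Fin (nP n)) : 0 ≤ thB n o j := by
  rcases o with _ | _ | _ | t
  · simp [thB]
  · simp [thB]
  · simp [thB]
  · simp only [thB, Sum.elim_inr]
    split_ifs <;> norm_num

/-- The theta programme has `3 + 2n²` constraints. -/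
theorem card_ThI (n : ℕ) : Fintype.card (ThI n) = 3 + 2 * n ^ 2 := by
  simp [Fintype.card_sum, Fintype.card_prod, Fintype.card_bool, Fintype.card_unique]
  ring

/-- The theta gate is a CONV gate of description `≤ 4 n² + 4`. -/
theorem thetaGate_isConvGate (n q : ℕ) : IsConvGate (4 * n ^ 2 + 4) (thetaGate n q) := by
  let p : ℕ := Fintype.card (ThI n)
  let eI : ThI n ≃ Fin p := Fintype.equivFin (ThI n)
  refine ⟨p, n, ?_, fun i => thA n (eI.symm i), fun i => thb n q (eI.symm i),
    fun i j => thB n (eI.symm i) j, fun i j => thB_nonneg n _ j, fun v => ?_⟩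
  · have hp : p = 3 + 2 * n ^ 2 := card_ThI n
    rw [hp]
    nlinarith [Nat.zero_le n, sq_nonneg (n : ℤ)]
  · rw [thetaGate_snd_eq_true_iff]
    unfold ThetaFeas
    constructor
    · rintro ⟨Y, hY, h⟩
      exact ⟨Y, hY, fun i => h (eI.symm i)⟩
    · rintro ⟨Y, hY, h⟩
      refine ⟨Y, hY, fun o => ?_⟩
      have := h (eI o)
      simp only [Equiv.symm_apply_apply] at this
      exact this

/-- The theta gate computes a monotone function. -/
theorem thetaGate_monotone (n q : ℕ) : Monotone (thetaGate n q).2 :=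
  (thetaGate_isConvGate n q).monotone

/-- `⟨J, Y⟩ = tr (J Y)` is the sum of the entries of `Y`. -/
theorem thJ_mul_trace (n : ℕ) (Y : Matrix (Fin n) (Fin n) ℝ) : (thJ n * Y).trace = entrySum Y := by
  simp only [Matrix.trace, Matrix.diag, Matrix.mul_apply, thJ, Matrix.of_apply, one_mul, entrySum]
  exact Finset.sum_comm

/-- **Cliques are accepted**: the clique vector of a `q`-set (`1 ≤ q`) is theta-feasible
(`Y = q⁻¹ 𝟙_S 𝟙_Sᵀ`). -/
theorem thetaFeas_cliqueVec {n q : ℕ} (S : Finset (Fin n)) (hS : #S = q) (hq : 1 ≤ q) :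
    ThetaFeas n q (fun j => cliqueVec S ((eqv n).symm j)) := by
  classical
  have hclique : (⊤ : SimpleGraph (Fin n)).IsNClique q S :=
    ⟨fun a _ c _ hac => (SimpleGraph.top_adj a c).2 hac, hS⟩
  obtain ⟨hfeas, hval⟩ := isThetaFeasible_cliqueMatrix hclique (by omega)
  have hk1 : (1 : ℝ) ≤ q := by exact_mod_cast hq
  refine ⟨(q : ℝ)⁻¹ • vecMulVec (indVec S) (indVec S), hfeas.posSemidef, fun o => ?_⟩
  have hentry : ∀ a c : Fin n, ((q : ℝ)⁻¹ • vecMulVec (indVec S) (indVec S)) a c =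
      if a ∈ S ∧ c ∈ S then (q : ℝ)⁻¹ else 0 := fun a c => by
    simp only [Matrix.smul_apply, vecMulVec_apply, indVec, smul_eq_mul, mul_ite, mul_one,
      mul_zero]
    by_cases ha : a ∈ S <;> by_cases hc : c ∈ S <;> simp [ha, hc]
  rcases o with _ | _ | _ | ⟨a, c, sgn⟩
  · -- `tr Y ≤ 1`
    simp only [thA, thb, thB, Sum.elim_inl, Matrix.one_mul, zero_mul, Finset.sum_const_zero, add_zero]
    exact hfeas.trace_eq_one.le
  · -- `-tr Y ≤ -1`
    simp only [thA, thb, thB, Sum.elim_inl, Sum.elim_inr, Matrix.neg_mul, Matrix.one_mul, Matrix.trace_neg,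
      zero_mul, Finset.sum_const_zero, add_zero]
    exact neg_le_neg hfeas.trace_eq_one.ge
  · -- `-⟨J, Y⟩ ≤ -q`
    simp only [thA, thb, thB, Sum.elim_inl, Sum.elim_inr, Matrix.neg_mul, Matrix.trace_neg, zero_mul,
      Finset.sum_const_zero, add_zero]
    rw [thJ_mul_trace, hval]
  · -- `± Y_ac ≤ [x_ac]`
    simp only [thA, thb, thB, Sum.elim_inr, Matrix.trace_single_mul, smul_eq_mul, zero_add]
    by_cases hac : a = c
    · rw [if_pos hac, zero_mul]
      exact Summit.PneNP.PneNP.Theorems.sum_edge_indicator_nonneg (eqv n) (cliqueVec S) _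
    · rw [if_neg hac, Summit.PneNP.PneNP.Theorems.sum_edge_indicator (eqv n) (cliqueVec S) hac, hentry]
      simp only [cliqueVec, decide_eq_true_eq, Sym2.mem_iff, forall_eq_or_imp, forall_eq]
      have hkinv : (0 : ℝ) ≤ (q : ℝ)⁻¹ := by positivity
      have hkinv1 : (q : ℝ)⁻¹ ≤ 1 := inv_le_one_of_one_le₀ hk1
      by_cases hS2 : a ∈ S ∧ c ∈ S <;> cases sgn <;> simp [hS2] <;> linarith

/-- **Colourings are rejected**: a `c`-colouring vector with `c < q` is theta-infeasible
(`q ≤ ⟨J, Y⟩ ≤ c`). -/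
theorem not_thetaFeas_colorVec {n q c : ℕ} (h : Fin n → Fin c) (hc : c < q) :
    ¬ ThetaFeas n q (fun j => colorVec h ((eqv n).symm j)) := by
  classical
  rintro ⟨Y, hY, hcon⟩
  -- `tr Y = 1`
  have htr : Y.trace = 1 := by
    have h1 := hcon (Sum.inl ())
    have h2 := hcon (Sum.inr (Sum.inl ()))
    simp only [thA, thb, thB, Sum.elim_inl, Sum.elim_inr, Matrix.one_mul, Matrix.neg_mul,
      Matrix.trace_neg, zero_mul, Finset.sum_const_zero, add_zero] at h1 h2
    linarith
  -- `q ≤ ⟨J, Y⟩`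
  have hsum : (q : ℝ) ≤ entrySum Y := by
    have h3 := hcon (Sum.inr (Sum.inr (Sum.inl ())))
    simp only [thA, thb, thB, Sum.elim_inl, Sum.elim_inr, Matrix.neg_mul, Matrix.trace_neg,
      zero_mul, Finset.sum_const_zero, add_zero] at h3
    rw [thJ_mul_trace] at h3
    linarith
  -- `Y` vanishes off the diagonal inside colour classes
  have h0 : ∀ u v : Fin n, u ≠ v → h u = h v → Y u v = 0 := by
    intro u v huv hhuv
    have h4 := hcon (Sum.inr (Sum.inr (Sum.inr (u, v, true))))
    have h5 := hcon (Sum.inr (Sum.inr (Sum.inr (u, v, false))))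
    simp only [thA, thb, thB, Sum.elim_inr, Matrix.trace_single_mul, smul_eq_mul, zero_add,
      if_neg huv, if_true] at h4 h5
    rw [Summit.PneNP.PneNP.Theorems.sum_edge_indicator (eqv n) (colorVec h) huv] at h4 h5
    simp only [colorVec, Sym2.map_mk, Sym2.mk_isDiag_iff, hhuv, decide_true, Bool.not_true,
      Bool.false_eq_true, if_false] at h4 h5
    norm_num at h4 h5
    linarith
  have hle := Summit.PneNP.PneNP.Theorems.entrySum_le_of_classes h hY htr h0
  have hcq : (c : ℝ) + 1 ≤ q := by exact_mod_cast hc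
  linarith

/-- Gate form: clique vectors (and anything above them) are accepted. -/
theorem thetaGate_accepts {n q : ℕ} (S : Finset (Fin n)) (hS : #S = q) (hq : 1 ≤ q)
    (v : Fin (nP n) → Bool) (hv : (fun j => cliqueVec S ((eqv n).symm j)) ≤ v) :
    (thetaGate n q).2 v = true := by
  have h1 : (thetaGate n q).2 (fun j => cliqueVec S ((eqv n).symm j)) = true :=
    (thetaGate_snd_eq_true_iff n q _).2 (thetaFeas_cliqueVec S hS hq)
  have h2 := thetaGate_monotone n q hv
  by_contra hne
  have hb : (thetaGate n q).2 v = false := by simpa using hne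
  exact absurd (h1.ge.trans (h2.trans hb.le)) (by decide)

/-- Gate form: colouring vectors with fewer than `q` colours (and anything below them) are rejected. -/
theorem thetaGate_rejects {n q c : ℕ} (h : Fin n → Fin c) (hc : c < q)
    (v : Fin (nP n) → Bool) (hv : v ≤ fun j => colorVec h ((eqv n).symm j)) :
    (thetaGate n q).2 v = false := by
  have h1 : (thetaGate n q).2 (fun j => colorVec h ((eqv n).symm j)) = false := by
    rw [← Bool.not_eq_true, thetaGate_snd_eq_true_iff]
    exact not_thetaFeas_colorVec h hc
  have h2 := thetaGate_monotone n q hv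
  by_contra hne
  have hb : (thetaGate n q).2 v = true := by simpa using hne
  exact absurd (hb.ge.trans (h2.trans h1.le)) (by decide)

end

end Summit.PneNP.PneNP.Theorems.CliqueExtLowerBound.Negative
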